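/-
PORT (pub-hodgecm2, COR-CM cell; slot b19 = executor of row Fg6, successor of model-2) of the stage-1 package file
`HodgeCMPerL/HodgeCM/StubTree/WeightDualUnit.lean` (pub-hodgecm HOME/lean, bytes of record md5 122b6bf90657, 378 lines).
Declarations VERBATIM; edits: the package import `StubTree.Qw8GysinDescentH0` re-pointed to `StubTree.Qw8Monomial2` (the MINIMAL F6
cone: the only declaration this file uses from the Gysin-descent cone is the fact `Fact_unitH0`, relocated VERBATIM to
`Geometry/GenericFacts.lean` (seat b20), which comes through `StubTree.Qw8Monomial1`, as do `Proofs.Prop22.Eigen`/`Proofs.Pohlmann.FactorAct`); namespace token `HodgeCM` ↦ `Summit.HodgeConjecture.CorCM`;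
linter fixes.  Generator: pub-hodgecm2-p1 portkit `build_kit.py` (via model-2's run).
-/
import Summits.HodgeConjecture.CorCM.StubTree.Qw8Monomial2
import HarnessLib

/-!
# F6 `Fact_weightDual` in FULL is a theorem of the (δ) inputs and T-CM

`Summit.HodgeConjecture.CorCM.StubTree.Qw8Monomial` (§8, `Universe.weightDual_of_facts`) derives the conclusion of F6
`Universe.Fact_weightDual` (`StubTree/Qw8Geometric.lean`) for weight vectors of POSITIVE degree and NON-FULL weight
`S' ≠ (univ)_i` from `ModelAxioms`, N1 `Fact_cupExterior`, F5 `Fact_cupAssoc`, M40 `Fact_dimProd` and T-CM `Fact_trTopCM`,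
and says why it stops there: "the signature has no cup unit" for the two edge cases

* (E0) degree `0` (`q = 0`): the partner of `w ∈ H⁰` must be a TOP class with `∫ w' ∪ w ≠ 0`;
* (E1) full weight `S' = (univ)_i` (`q = dim`): the partner must be a class of degree `0` with `∫ w ∪ w' ≠ 0`.

The unit classes of M43 `Fact_unitH0` (`StubTree/Qw8GysinDescentH0.lean`: `1_X ∈ H⁰(X, ℚ)`, natural, a LEFT unit
`1 ∪ z = z`, spanning `H⁰` of every CM product) are exactly that cup unit, and this file closes both edge cases:

`Universe.weightDual_of_unitH0 : ModelAxioms → N1 → F5 → Fact_dimProd → Fact_trTopCM → Fact_unitH0 → Fact_weightDual`.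

So F6 — FACTS.md §1c: "class M, UNWITNESSED, no toy witness, refuted in the exterior toy family" — is IMPLIED by the
hypothesis list of the unit-class presentation `Assembly.COR_CM_of_descentFactsB` plus T-CM; with toy-g3's
`Model/ToyG2/DescentFacts3` + `TrTop3` (every one of these six hypotheses holds in `toyUniverse₃ d t`) it becomes
WITNESSED jointly with M1–M28 (`Summit.HodgeConjecture.CorCM.Model.ToyG2.WeightDual3`, this seat's second file).

## The one new lemma: the RIGHT unit on CM products, derived (not posited)

M43 only gives the LEFT unit `1 ∪ z = z`; F6 (E0) needs `∫ e_top ∪ 1 ≠ 0`, i.e. a right unit at the top monomial.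
No commutativity of `cup` is available in the signature, but on `A' = ∏_j A_{(F,Θ_j)}` the right unit FOLLOWS:
for an eigenform `x = x_{j,τ} ∈ H¹(A', ℂ)` (`fvec`), `x ∪ 1` is a weight vector of the weight `{(j,τ)}` of `x`
(M3 `pull_cup`: `isWeightVector_cupC_of_disjoint`, the unit having weight `(∅)_j` by naturality), hence `= c · x`
(weight spaces in positive degree are the LINES spanned by the eigen-monomials: `WeightLines`,
`weightSpace_eq_monoSpan` + `monoSpan_le_span_fmono`, N1); and by F5 and the left unit
`(x ∪ 1) ∪ z = x ∪ (1 ∪ z) = x ∪ z`, so `(c - 1) · (x ∪ z) = 0`; with `z` the complementary eigen-monomial,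
`x ∪ z = ± e_top ≠ 0` (`fmono_ne_zero`), whence `c = 1` (`cupC_fvec_one`).  By F5 again `e_I ∪ 1 = e_I` for every
eigen-monomial (`cupC_fmono_one`).  Then:

* (E0) `w = c ⊗ 1` (`Fact_unitH0` (iii)); the weight equation at a factor-wise multiplication by `2 ∈ 𝓞_F`
  (`exists_isFactorAct`, M1+M18+M24) reads `2^{|S'_j|} = 1`, so `S' = (∅)_j`; partner `e_top`, of weight
  `(univ)_j = (∅ᶜ)_j`; `∫ e_top ∪ (c ⊗ 1) = c ∫ e_top ≠ 0` (right unit, T-CM via `trC_fmono_ne_zero`) and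
  `∫ (c ⊗ 1) ∪ e_top = c ∫ e_top ≠ 0` (left unit) — `weightDual_zero`;
* (E1) `w = c · e_I` with `e_I` an injective eigen-monomial of full weight, so `I` = all indices and
  `deg w = |I| = 2 dim A'` (`card_index`, `two_mul_dim_cmProd_of_dimProd`), `q = dim`; partner `1 ⊗ 1` of weight
  `(∅)_j = (univᶜ)_j` in degree `0 = 2 (dim - q)`; both traces are `c ∫ e_I ≠ 0` — `weightDual_univ`;
* the bulk case is `weightDual_of_facts` verbatim.

LEDGER REMARK (qw8b-g7, STATUS 12:48:22Z).  This is a statement about F6, NOT about route (δ): the unit-class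
presentation `Assembly.COR_CM_of_descentFactsB` / `…B₄` needs NEITHER F6 nor T-CM `Fact_trTopCM` (and the
generation-1 `toyModel` REFUTES T-CM, FACTS.md §0-R24 (1)); T-CM enters here only because F6 itself asks for
non-vanishing TRACES.  So nothing is added to the [QW8]-side binder list of route (δ); what changes is the status
of the binder F6 of the OLDER geometric end states `COR_CM_of_qw8Facts` / `COR_CM_of_geometricFacts` /
`COR_CM_of_openInputsGeometric`: implied by (δ)'s hypotheses + T-CM, and witnessed in `toyUniverse₃`.

Nothing is cited and nothing is posited: every hypothesis is a named `def` of the tree consumed as a binder.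
Main declarations: `cupC_tmul_one_left`, `exists_eq_tmul_one`, `cupC_fvec_one`, `cupC_fmono_one` (right unit),
`weightDual_zero`, `weightDual_univ`, `weightDual_of_unitH0`, and the bundled corollary `weightDual_of_descentInputs`.
-/

noncomputable section

open scoped TensorProduct NumberField Classical

namespace Summit.HodgeConjecture.CorCM

open Literature.AlgebraicGeometry.Motives

namespace Universe

variable {U : Universe}

/-! ## 1. Unit classes with complex coefficients -/

section Unit

variable (one : ∀ X : U.Var, U.Coh X 0)

/-- The left unit, complexified: `(c ⊗ 1_X) ∪ z = c · z` (up to the degree transport `l = 0 + l`). -/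
theorem cupC_tmul_one_left
    (hcup : ∀ (X : U.Var) (l : ℕ) (z : U.Coh X l), U.cup X 0 l (one X) z = U.castCoh X (Nat.zero_add l).symm z)
    (X : U.Var) (c : ℂ) (l : ℕ) (z : U.CohC X l) :
    U.cupC X 0 l (c ⊗ₜ one X) z = c • U.castC X (Nat.zero_add l).symm z := by
  induction z using TensorProduct.induction_on with
  | zero => rw [map_zero, map_zero, smul_zero]
  | add z z' hz hz' => rw [map_add, hz, hz', map_add, smul_add]
  | tmul b y => rw [cupC_tmul, hcup, castC_tmul, TensorProduct.smul_tmul', smul_eq_mul]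

/-- Pull-backs fix `c ⊗ 1`. -/
theorem pullC_tmul_one (hpull : ∀ (X Y : U.Var) (f : U.Mor X Y), U.pull f 0 (one Y) = one X)
    {X Y : U.Var} (f : U.Mor X Y) (c : ℂ) : U.pullC f 0 (c ⊗ₜ one Y) = c ⊗ₜ one X := by
  rw [pullC_tmul, hpull]

/-- `c ⊗ 1_{A'}` is a weight vector of weight `(∅)_j`. -/
theorem isWeightVector_tmul_one (hpull : ∀ (X Y : U.Var) (f : U.Mor X Y), U.pull f 0 (one Y) = one X)
    (F : CMField) {n : ℕ} (Θ : Fin (n + 1) → CMType F) (c : ℂ) :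
    U.IsWeightVector F Θ (fun _ => ∅) 0 (c ⊗ₜ one (U.cmProd F Θ)) := by
  intro j a Ma _
  rw [Finset.prod_empty, one_smul, pullC_tmul_one one hpull]

/-- Every class in `H⁰(A', ℂ)` is `c ⊗ 1_{A'}` (from `H⁰(A', ℚ) = ℚ · 1`). -/
theorem exists_eq_tmul_one
    (hspan : ∀ (F : CMField) (n : ℕ) (Θ : Fin (n + 1) → CMType F) (e : U.Coh (U.cmProd F Θ) 0),
      ∃ r : ℚ, e = r • one (U.cmProd F Θ))
    (F : CMField) {n : ℕ} (Θ : Fin (n + 1) → CMType F) (w : U.CohC (U.cmProd F Θ) 0) :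
    ∃ c : ℂ, w = c ⊗ₜ one (U.cmProd F Θ) := by
  induction w using TensorProduct.induction_on with
  | zero => exact ⟨0, by rw [TensorProduct.zero_tmul]⟩
  | add w w' hw hw' =>
    obtain ⟨c, rfl⟩ := hw
    obtain ⟨c', rfl⟩ := hw'
    exact ⟨c + c', by rw [TensorProduct.add_tmul]⟩
  | tmul b e =>
    obtain ⟨r, rfl⟩ := hspan F n Θ e
    exact ⟨r • b, by rw [TensorProduct.smul_tmul]⟩

end Unit

/-- A CM field has at least two complex embeddings (`[F:ℚ] = 2g ≥ 2`). -/
theorem one_lt_card_embeddings (F : CMField) : 1 < Fintype.card ((F : Type) →+* ℂ) := by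
  rw [NumberField.Embeddings.card]
  have h1 := two_mul_halfDegree F
  have h2 : 0 < Module.finrank ℚ (F : Type) := Module.finrank_pos
  omega

/-- The index set of the eigenforms of `∏_{j ≤ m} A_{Θ'_j}` is nonempty. -/
theorem index_nonempty (F : CMField) (m : ℕ) : Nonempty (Fin (m + 1) × ((F : Type) →+* ℂ)) := by
  apply Fintype.card_pos_iff.mp
  rw [card_index]
  exact Nat.mul_pos (Nat.succ_pos m) Module.finrank_pos

/-! ## 2. The right unit on CM products, derived from F5 + the left unit + N1 -/

section Mono

variable {F : CMField} {m : ℕ} (Θ' : Fin (m + 1) → CMType F)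
  (x : (j : Fin (m + 1)) → ((F : Type) →+* ℂ) → U.CohC (U.cmAV F (Θ' j)) 1)
  (one : ∀ X : U.Var, U.Coh X 0)

/-- **Right unit on eigenforms**: `x_{j,τ} ∪ 1 = x_{j,τ}` for the pulled-back eigenclasses `fvec x (j, τ)` of
eigenbases `x` (M3 weight computation + weight lines + F5 + left unit + a complementary monomial). -/
theorem cupC_fvec_one (M : U.ModelAxioms) (hN1 : U.Fact_cupExterior) (h5 : U.Fact_cupAssoc)
    (hx : ∀ j τ, x j τ ∈ U.eigenLine F (Θ' j) τ) (hsp : ∀ j, Submodule.span ℂ (Set.range (x j)) = ⊤)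
    (hpull : ∀ (X Y : U.Var) (f : U.Mor X Y), U.pull f 0 (one Y) = one X)
    (hcup : ∀ (X : U.Var) (l : ℕ) (z : U.Coh X l), U.cup X 0 l (one X) z = U.castCoh X (Nat.zero_add l).symm z)
    (q₀ : Fin (m + 1) × ((F : Type) →+* ℂ)) :
    U.cupC (U.cmProd F Θ') 1 0 (U.fvec x q₀) ((1 : ℂ) ⊗ₜ one (U.cmProd F Θ')) = U.fvec x q₀ := by
  -- the constant index map of length one
  have hp : Function.Injective (fun _ : Fin (0 + 1) => q₀) := fun i j _ =>
    Fin.ext (by have := i.2; have := j.2; omega)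
  have hns : ¬ Function.Surjective (fun _ : Fin (0 + 1) => q₀) := by
    intro hs
    obtain ⟨s, hs'⟩ := Fintype.exists_ne_of_one_lt_card (one_lt_card_embeddings F) q₀.2
    obtain ⟨i, hi⟩ := hs (q₀.1, s)
    exact hs' (congrArg Prod.snd hi).symm
  have hE := hN1 F m Θ' 0
  -- `x ∪ 1` is a weight vector of the weight of `x`
  have hwx : U.IsWeightVector F Θ' (wtOf 0 fun _ : Fin (0 + 1) => q₀) (0 + 1) (U.fvec x q₀) := by
    have h := isWeightVector_fmono x M hx 0 (fun _ : Fin (0 + 1) => q₀) hp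
    rw [fmono_eq, cupPowC_zero_apply, Function.comp_apply] at h
    exact h
  have hy : U.IsWeightVector F Θ' (fun j => wtOf 0 (fun _ : Fin (0 + 1) => q₀) j ∪ ∅) (1 + 0)
      (U.cupC (U.cmProd F Θ') 1 0 (U.fvec x q₀) ((1 : ℂ) ⊗ₜ one (U.cmProd F Θ'))) :=
    isWeightVector_cupC_of_disjoint M.pull_cup (fun j => Finset.disjoint_empty_right _) hwx
      (isWeightVector_tmul_one one hpull F Θ' 1)
  simp only [Finset.union_empty] at hy
  -- hence a multiple of `x`
  have hmem : U.cupC (U.cmProd F Θ') 1 0 (U.fvec x q₀) ((1 : ℂ) ⊗ₜ one (U.cmProd F Θ')) ∈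
      U.monoSpan x 0 (wtOf 0 fun _ : Fin (0 + 1) => q₀) := by
    rw [← weightSpace_eq_monoSpan x M hx hE hsp]
    exact (U.mem_weightSpace_iff F Θ' _ (0 + 1) _).2 hy
  obtain ⟨c, hc⟩ := Submodule.mem_span_singleton.mp (monoSpan_le_span_fmono x hE _ hmem)
  -- `hc : c • fmono x 0 (fun _ => q₀) = x ∪ 1`
  -- the complementary monomial `z`, with `x ∪ z ≠ 0`
  obtain ⟨l', p', hp', h1, -, -⟩ := exists_compl_enum (fun _ : Fin (0 + 1) => q₀) hp hns
  have hinj : Function.Injective (Fin.append (fun _ : Fin (0 + 1) => q₀) p' : Fin (0 + 1 + (l' + 1)) → _) :=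
    Fin.append_injective_iff.mpr ⟨hp, hp', fun i j h => h1 j ⟨i, h⟩⟩
  have hne : U.cupC (U.cmProd F Θ') (0 + 1) (l' + 1) (U.fmono x 0 fun _ : Fin (0 + 1) => q₀) (U.fmono x l' p') ≠ 0 := by
    rw [U.cupC_fmono_fmono x h5]
    exact fmono_ne_zero x M hN1 hx hsp hinj
  -- associativity + left unit: `(x ∪ 1) ∪ z = x ∪ z`
  have hassoc := cupC_assoc U h5 (U.cmProd F Θ') 1 0 (l' + 1) (U.fvec x q₀) ((1 : ℂ) ⊗ₜ one (U.cmProd F Θ'))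
    (U.fmono x l' p')
  rw [cupC_tmul_one_left one hcup, one_smul, cupC_castC_right, castC_castC] at hassoc
  have key : U.cupC (U.cmProd F Θ') (1 + 0) (l' + 1)
      (U.cupC (U.cmProd F Θ') 1 0 (U.fvec x q₀) ((1 : ℂ) ⊗ₜ one (U.cmProd F Θ'))) (U.fmono x l' p') =
      U.cupC (U.cmProd F Θ') 1 (l' + 1) (U.fvec x q₀) (U.fmono x l' p') := by
    rw [hassoc]
    exact U.castC_self _ _ _
  rw [← hc, map_smul, LinearMap.smul_apply] at key
  -- `key : c • (x ∪ z) = x ∪ z` (the two sides in the degrees `1 + 0 + (l'+1)` and `1 + (l'+1)`)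
  have key2 : (c - 1) • U.cupC (U.cmProd F Θ') (0 + 1) (l' + 1) (U.fmono x 0 fun _ : Fin (0 + 1) => q₀)
      (U.fmono x l' p') = 0 := by
    rw [sub_smul, one_smul, sub_eq_zero]
    exact key
  have hc1 : c = 1 := by
    rcases smul_eq_zero.mp key2 with h | h
    · exact sub_eq_zero.mp h
    · exact absurd h hne
  rw [← hc, hc1, one_smul]
  rfl

/-- **Right unit on eigen-monomials**: `e_I ∪ 1 = e_I` (F5, induction on the length). -/
theorem cupC_fmono_one (M : U.ModelAxioms) (hN1 : U.Fact_cupExterior) (h5 : U.Fact_cupAssoc)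
    (hx : ∀ j τ, x j τ ∈ U.eigenLine F (Θ' j) τ) (hsp : ∀ j, Submodule.span ℂ (Set.range (x j)) = ⊤)
    (hpull : ∀ (X Y : U.Var) (f : U.Mor X Y), U.pull f 0 (one Y) = one X)
    (hcup : ∀ (X : U.Var) (l : ℕ) (z : U.Coh X l), U.cup X 0 l (one X) z = U.castCoh X (Nat.zero_add l).symm z) :
    ∀ (k : ℕ) (p : Fin (k + 1) → Fin (m + 1) × ((F : Type) →+* ℂ)),
      U.cupC (U.cmProd F Θ') (k + 1) 0 (U.fmono x k p) ((1 : ℂ) ⊗ₜ one (U.cmProd F Θ')) = U.fmono x k p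
  | 0, p => by
    rw [fmono_eq, cupPowC_zero_apply, Function.comp_apply]
    exact cupC_fvec_one Θ' x one M hN1 h5 hx hsp hpull hcup (p 0)
  | k + 1, p => by
    rw [fmono_eq, cupPowC_succ_apply, cupC_assoc U h5, Function.comp_apply,
      cupC_fvec_one Θ' x one M hN1 h5 hx hsp hpull hcup (p (Fin.last (k + 1)))]
    exact U.castC_self _ _ _

/-! ## 3. The two edge cases of F6 in monomial degrees -/

/-- **(E0) degree zero.**  A nonzero weight vector `w₀ ∈ H⁰(A', ℂ)` of weight `S'` has `S' = (∅)_j`, and the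
top eigen-monomial `e_top` (degree `2 dim A'`, weight `(univ)_j`) pairs non-trivially with it on both sides. -/
theorem weightDual_zero (M : U.ModelAxioms) (hN1 : U.Fact_cupExterior) (h5 : U.Fact_cupAssoc)
    (hd : U.Fact_dimProd) (ht : U.Fact_trTopCM)
    (hx : ∀ j τ, x j τ ∈ U.eigenLine F (Θ' j) τ) (hsp : ∀ j, Submodule.span ℂ (Set.range (x j)) = ⊤)
    (hpull : ∀ (X Y : U.Var) (f : U.Mor X Y), U.pull f 0 (one Y) = one X)
    (hcup : ∀ (X : U.Var) (l : ℕ) (z : U.Coh X l), U.cup X 0 l (one X) z = U.castCoh X (Nat.zero_add l).symm z)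
    (hspan : ∀ (F : CMField) (n : ℕ) (Θ : Fin (n + 1) → CMType F) (e : U.Coh (U.cmProd F Θ) 0),
      ∃ r : ℚ, e = r • one (U.cmProd F Θ))
    {S' : Fin (m + 1) → Finset ((F : Type) →+* ℂ)} {w₀ : U.CohC (U.cmProd F Θ') 0}
    (hw : U.IsWeightVector F Θ' S' 0 w₀) (hw0 : w₀ ≠ 0) :
    S' = (fun _ => ∅) ∧
      ∃ (K : ℕ) (y' : U.CohC (U.cmProd F Θ') (K + 1)), K + 1 = 2 * U.dim (U.cmProd F Θ') ∧
        U.IsWeightVector F Θ' (fun _ => Finset.univ) (K + 1) y' ∧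
        U.trC (U.cmProd F Θ') (K + 1 + 0) (U.cupC (U.cmProd F Θ') (K + 1) 0 y' w₀) ≠ 0 ∧
        U.trC (U.cmProd F Θ') (0 + (K + 1)) (U.cupC (U.cmProd F Θ') 0 (K + 1) w₀ y') ≠ 0 := by
  obtain ⟨c, rfl⟩ := exists_eq_tmul_one one hspan F Θ' w₀
  have hc : c ≠ 0 := by rintro rfl; exact hw0 (TensorProduct.zero_tmul _ _)
  -- the weight is empty: test with the factor-wise multiplications by `2 ∈ 𝓞_F`
  have hS : S' = fun _ => ∅ := by
    funext j
    obtain ⟨Mj, hMj⟩ := exists_isFactorAct M F Θ' j (2 : 𝓞 F)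
    have h := hw j _ Mj hMj
    rw [pullC_tmul_one one hpull] at h
    have h2 : ∀ s : (F : Type) →+* ℂ, s ((2 : 𝓞 F) : F) = 2 := fun s => by
      rw [NumberField.RingOfIntegers.coe_eq_algebraMap, map_ofNat, map_ofNat]
    simp only [h2, Finset.prod_const] at h
    have h3 : ((2 : ℂ) ^ (S' j).card - 1) • (c ⊗ₜ[ℚ] one (U.cmProd F Θ')) = 0 := by
      rw [sub_smul, one_smul, ← h, sub_self]
    rcases smul_eq_zero.mp h3 with h4 | h4
    · rw [sub_eq_zero] at h4
      have h6 : 2 ^ (S' j).card = 1 := by exact_mod_cast h4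
      rw [Nat.pow_eq_one] at h6
      exact Finset.card_eq_zero.mp (h6.resolve_left (by norm_num))
    · exact absurd h4 hw0
  refine ⟨hS, ?_⟩
  -- the top monomial: an injective enumeration of ALL indices
  have hns : ¬ Function.Surjective (fun i : Fin 0 => (i.elim0 : Fin (m + 1) × ((F : Type) →+* ℂ))) := by
    intro hs
    obtain ⟨z⟩ := index_nonempty F m
    obtain ⟨i, -⟩ := hs z
    exact i.elim0
  obtain ⟨K, qK, hqK, -, h2, hcard⟩ := exists_compl_enum (fun i : Fin 0 => (i.elim0 : Fin (m + 1) × ((F : Type) →+* ℂ)))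
    (fun i => i.elim0) hns
  have hsurj : Function.Surjective qK := fun z => h2 z (by rintro ⟨i, -⟩; exact i.elim0)
  have hdeg : K + 1 = 2 * U.dim (U.cmProd F Θ') := by
    rw [two_mul_dim_cmProd_of_dimProd M hd, ← card_index]; omega
  have htop : U.trC (U.cmProd F Θ') (K + 1) (U.fmono x K qK) ≠ 0 := by
    have h := trC_fmono_ne_zero x M hN1 ht hx hsp hqK hdeg
    rw [trC_castC] at h
    exact h
  refine ⟨K, U.fmono x K qK, hdeg, ?_, ?_, ?_⟩
  · rw [← wtOf_eq_univ_of_surjective hsurj]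
    exact isWeightVector_fmono x M hx K qK hqK
  · have e1 : c ⊗ₜ[ℚ] one (U.cmProd F Θ') = c • ((1 : ℂ) ⊗ₜ[ℚ] one (U.cmProd F Θ')) := by
      rw [TensorProduct.smul_tmul', smul_eq_mul, mul_one]
    rw [e1, map_smul, cupC_fmono_one Θ' x one M hN1 h5 hx hsp hpull hcup, map_smul, smul_eq_mul]
    exact mul_ne_zero hc htop
  · rw [cupC_tmul_one_left one hcup, map_smul, trC_castC, smul_eq_mul]
    exact mul_ne_zero hc htop

/-- **(E1) full weight.**  A nonzero weight vector of weight `(univ)_j` in degree `l + 1` is a multiple of the top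
eigen-monomial, so `l + 1 = 2 dim A'`, and `1 ⊗ 1` (degree `0`, weight `(∅)_j`) pairs non-trivially with it on
both sides. -/
theorem weightDual_univ (M : U.ModelAxioms) (hN1 : U.Fact_cupExterior) (h5 : U.Fact_cupAssoc)
    (hd : U.Fact_dimProd) (ht : U.Fact_trTopCM)
    (hx : ∀ j τ, x j τ ∈ U.eigenLine F (Θ' j) τ) (hsp : ∀ j, Submodule.span ℂ (Set.range (x j)) = ⊤)
    (hpull : ∀ (X Y : U.Var) (f : U.Mor X Y), U.pull f 0 (one Y) = one X)
    (hcup : ∀ (X : U.Var) (l : ℕ) (z : U.Coh X l), U.cup X 0 l (one X) z = U.castCoh X (Nat.zero_add l).symm z)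
    {l : ℕ} {y : U.CohC (U.cmProd F Θ') (l + 1)}
    (hy : U.IsWeightVector F Θ' (fun _ => Finset.univ) (l + 1) y) (hy0 : y ≠ 0) :
    l + 1 = 2 * U.dim (U.cmProd F Θ') ∧
      U.IsWeightVector F Θ' (fun _ => ∅) 0 ((1 : ℂ) ⊗ₜ one (U.cmProd F Θ')) ∧
      U.trC (U.cmProd F Θ') (0 + (l + 1)) (U.cupC (U.cmProd F Θ') 0 (l + 1) ((1 : ℂ) ⊗ₜ one (U.cmProd F Θ')) y) ≠ 0 ∧
      U.trC (U.cmProd F Θ') (l + 1 + 0) (U.cupC (U.cmProd F Θ') (l + 1) 0 y ((1 : ℂ) ⊗ₜ one (U.cmProd F Θ'))) ≠ 0 := by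
  obtain ⟨p, hp, hwt, c, rfl⟩ := U.exists_eq_smul_fmono x M hN1 hx hsp hy hy0
  have hc : c ≠ 0 := by rintro rfl; exact hy0 (zero_smul _ _)
  have hsurj : Function.Surjective p := by
    rintro ⟨j, s⟩
    have h : s ∈ wtOf l p j := by rw [congrFun hwt j]; exact Finset.mem_univ s
    exact (mem_wtOf_iff p j s).mp h
  have hdeg : l + 1 = 2 * U.dim (U.cmProd F Θ') := by
    rw [two_mul_dim_cmProd_of_dimProd M hd, ← card_index, ← Fintype.card_fin (l + 1)]
    exact Fintype.card_of_bijective ⟨hp, hsurj⟩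
  have htop : U.trC (U.cmProd F Θ') (l + 1) (U.fmono x l p) ≠ 0 := by
    have h := trC_fmono_ne_zero x M hN1 ht hx hsp hp hdeg
    rw [trC_castC] at h
    exact h
  refine ⟨hdeg, isWeightVector_tmul_one one hpull F Θ' 1, ?_, ?_⟩
  · rw [cupC_tmul_one_left one hcup, one_smul, trC_castC, map_smul, smul_eq_mul]
    exact mul_ne_zero hc htop
  · rw [map_smul, LinearMap.smul_apply, cupC_fmono_one Θ' x one M hN1 h5 hx hsp hpull hcup, map_smul, smul_eq_mul]
    exact mul_ne_zero hc htop

end Mono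

/-! ## 4. F6 in full -/

/-- **F6 `Fact_weightDual` (verbatim, all degrees and all weights) is a THEOREM of `ModelAxioms`, N1 `Fact_cupExterior`,
F5 `Fact_cupAssoc`, M40 `Fact_dimProd`, T-CM `Fact_trTopCM` and M43 `Fact_unitH0`.** -/
theorem weightDual_of_unitH0 (M : U.ModelAxioms) (hN1 : U.Fact_cupExterior) (h5 : U.Fact_cupAssoc)
    (hd : U.Fact_dimProd) (ht : U.Fact_trTopCM) (hu : U.Fact_unitH0) : U.Fact_weightDual := by
  intro F m Θ' q S' w hw0 hw
  obtain ⟨one, hpull, hcup, hspan⟩ := hu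
  obtain ⟨β, -, hβ⟩ := exists_integral_injective_eval F
  choose xB hxB _hx0 hsp using fun i => exists_eigenbasis M F (Θ' i) β hβ
  rcases Nat.eq_zero_or_pos q with hq | hq
  · -- (E0) degree zero
    have h0 : 2 * q = 0 := by omega
    have hw' := U.isWeightVector_castC F Θ' S' h0 hw
    have hw0' : U.castC _ h0 w ≠ 0 := fun h => hw0 ((LinearEquiv.map_eq_zero_iff _).mp h)
    obtain ⟨hS, K, y', hK, hwt', tr1, tr2⟩ :=
      weightDual_zero Θ' xB one M hN1 h5 hd ht hxB hsp hpull hcup hspan hw' hw0'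
    subst hS
    have h1 : K + 1 = 2 * (U.dim (U.cmProd F Θ') - q) := by omega
    have e : w = U.castC _ h0.symm (U.castC _ h0 w) := by rw [castC_castC, castC_self]
    refine ⟨by omega, U.castC _ h1 y', ?_, ?_, ?_⟩
    · simp only [Finset.compl_empty]
      exact U.isWeightVector_castC F Θ' _ h1 hwt'
    · rw [e, cupC_castC_left, cupC_castC_right, castC_castC, trC_castC]; exact tr1
    · rw [e, cupC_castC_left, cupC_castC_right, castC_castC, trC_castC]; exact tr2
  · by_cases hS' : S' = fun _ => Finset.univ
    · -- (E1) full weight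
      subst hS'
      obtain ⟨l, hl⟩ : ∃ l, 2 * q = l + 1 := ⟨2 * q - 1, by omega⟩
      have hw' := U.isWeightVector_castC F Θ' _ hl hw
      have hw0' : U.castC _ hl w ≠ 0 := fun h => hw0 ((LinearEquiv.map_eq_zero_iff _).mp h)
      obtain ⟨hdeg, hwt', tr1, tr2⟩ := weightDual_univ Θ' xB one M hN1 h5 hd ht hxB hsp hpull hcup hw' hw0'
      have h1 : 0 = 2 * (U.dim (U.cmProd F Θ') - q) := by omega
      have e : w = U.castC _ hl.symm (U.castC _ hl w) := by rw [castC_castC, castC_self]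
      refine ⟨by omega, U.castC _ h1 ((1 : ℂ) ⊗ₜ one (U.cmProd F Θ')), ?_, ?_, ?_⟩
      · simp only [Finset.compl_univ]
        exact U.isWeightVector_castC F Θ' _ h1 hwt'
      · rw [e, cupC_castC_left, cupC_castC_right, castC_castC, trC_castC]; exact tr1
      · rw [e, cupC_castC_left, cupC_castC_right, castC_castC, trC_castC]; exact tr2
    · -- the bulk: `weightDual_of_facts`
      obtain ⟨hlt, rest⟩ := U.weightDual_of_facts Θ' M hN1 h5 hd ht q S' w hw0 hw hq hS'
      exact ⟨hlt.le, rest⟩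

/-- **F6 from the hypothesis list of the unit-class presentation + T-CM**: the binders of
`Assembly.COR_CM_of_descentFactsB` that F6 needs (`ModelAxioms`, N1, F5, M43, M40) together with `Fact_trTopCM`
imply `Fact_weightDual`; in particular F6 is not an independent input next to them. -/
theorem weightDual_of_descentInputs (M : U.ModelAxioms)
    (h : U.Fact_cupExterior ∧ U.Fact_cupAssoc ∧ U.Fact_unitH0 ∧ U.Fact_dimProd ∧ U.Fact_trTopCM) :
    U.Fact_weightDual :=
  weightDual_of_unitH0 M h.1 h.2.1 h.2.2.2.1 h.2.2.2.2 h.2.2.1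

end Universe

end Summit.HodgeConjecture.CorCM

end
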